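import Literature.Analysis.FluidPDE.KatoLaiCylinderCongr
import Literature.Analysis.FluidPDE.KatoLaiTorusOperatorLipschitz
import HarnessLib

/-!
# Kato–Lai's operator is a bilinear form evaluated on the diagonal

Analysis/FluidPDE support file for the energy-method construction of Euler flows in the
periodic cylinder (`Literature.Analysis.FluidPDE.KatoLai1984_periodicCylinderUniformExistence`;
Kato–Lai 1984, §4: `F(v, u) = (v·∇)u` is bilinear, `A(v) = F(Pv, v) − QF(Pv, Pv)` (5.6)).
At the smooth level, for smooth real torus fields `U, V`:

* the Leray part and the Helmholtz gradient depend linearly on the field on the closed cylinder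
  (`lerayPart_add_eqOn`, `lerayPart_smul_eqOn`, `qGrad`, `qGrad_add_eqOn`, `qGrad_smul_eqOn`,
  `qGrad_congr`), so `transportRep` is linear (`transportRep_add`, `transportRep_smul`);
* `presBil U V = torusRep (Q-gradient of (PU·∇_K)(PV))`, bilinear, `presBil U U = pressureRep U`;
* **`klBil U V = ((T U)·∇) V − ½ (presBil U V + presBil V U)`**, bilinear in each argument,
  with **`klBil U U = klOp U`** (`klBil_self`).

Everything is proved; no named fact and no `sorry` is introduced.

## References

* T. Kato, C. Y. Lai, J. Funct. Anal. 56 (1984) 15–28, §4, §5 (5.6). [KatoLai1984]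
-/

noncomputable section

open MeasureTheory Set Function Filter Topology TopologicalSpace
open scoped NNReal ENNReal InnerProductSpace RealInnerProductSpace ContDiff

namespace Literature.Analysis.FluidPDE

open FunctionSpaces FunctionSpaces.Torus UnitAddTorus

/-- Local notation for physical space `ℝ³ = EuclideanSpace ℝ (Fin 3)`. -/
local notation "ℝ³" => EuclideanSpace ℝ (Fin 3)

/-- Local notation for the closed cylinder `{r ≤ 1}`. -/
local notation "𝕂" => closure (SetLike.coe unitCylinder : Set (EuclideanSpace ℝ (Fin 3)))

namespace PeriodicCylinder

variable {L : ℝ} (hL : 0 < L)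

/-! ### Linearity of the Leray part on the closed cylinder -/

/-- `P (u + u') = P u + P u'` on the closed cylinder. [folklore] -/
theorem lerayPart_add_eqOn {u u' : ℝ³ → ℝ³} (hu : IsSmoothPeriodic L u) (hu' : IsSmoothPeriodic L u') (hs : IsSmoothPeriodic L fun x => u x + u' x) :
    EqOn (lerayPart hL hs) (fun x => lerayPart hL hu x + lerayPart hL hu' x) 𝕂 := by
  have hw := isSmoothPeriodic_lerayPart hL hu
  have hw' := isSmoothPeriodic_lerayPart hL hu'
  have hws := isSmoothPeriodic_lerayPart hL hs
  refine eqOn_closure_of_eqOn_cell hL hws.continuousOn (hw.add hw').continuousOn hws.periodic (hw.add hw').periodic ?_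
  refine eqOn_cylinderCell_of_toCell_eq hws.continuousOn (hw.add hw').continuousOn ?_
  rw [← lerayProj_eq_lerayPart hL hs, toCell_add hu.memLp hu'.memLp, map_add, lerayProj_eq_lerayPart hL hu,
    lerayProj_eq_lerayPart hL hu', ← toCell_add hw.memLp hw'.memLp]

/-- `P (c u) = c P u` on the closed cylinder. [folklore] -/
theorem lerayPart_smul_eqOn (c : ℝ) {u : ℝ³ → ℝ³} (hu : IsSmoothPeriodic L u) (hs : IsSmoothPeriodic L fun x => c • u x) :
    EqOn (lerayPart hL hs) (fun x => c • lerayPart hL hu x) 𝕂 := by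
  have hw := isSmoothPeriodic_lerayPart hL hu
  have hws := isSmoothPeriodic_lerayPart hL hs
  refine eqOn_closure_of_eqOn_cell hL hws.continuousOn (hw.const_smul c).continuousOn hws.periodic (hw.const_smul c).periodic ?_
  refine eqOn_cylinderCell_of_toCell_eq hws.continuousOn (hw.const_smul c).continuousOn ?_
  rw [← lerayProj_eq_lerayPart hL hs, toCell_const_smul c hu.memLp, map_smul, lerayProj_eq_lerayPart hL hu, ← toCell_const_smul c hw.memLp]

/-! ### The Helmholtz gradient of a smooth periodic field -/

/-- **The Helmholtz gradient** `Q b = ∇_K q̂(b)` of a smooth periodic field. [cite: KatoLai1984, §4 (i)] -/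
def qGrad {b : ℝ³ → ℝ³} (hb : IsSmoothPeriodic L b) : ℝ³ → ℝ³ := cylGrad (lerayPot hL hb)

/-- It is smooth periodic. [folklore] -/
theorem isSmoothPeriodic_qGrad {b : ℝ³ → ℝ³} (hb : IsSmoothPeriodic L b) : IsSmoothPeriodic L (qGrad hL hb) :=
  (isSmoothPeriodic_lerayPot hL hb).cylGrad

/-- Its cell class is the Helmholtz projection. [folklore] -/
theorem toCell_qGrad {b : ℝ³ → ℝ³} (hb : IsSmoothPeriodic L b) : toCell L (qGrad hL hb) = helmholtzProj L (toCell L b) :=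
  ((lerayPot_spec hL hb).2.1).symm

/-- `Q` only depends on the cell class: fields agreeing on the cell have the same Helmholtz gradient
on the closed cylinder. [folklore] -/
theorem qGrad_congr {b b' : ℝ³ → ℝ³} (hb : IsSmoothPeriodic L b) (hb' : IsSmoothPeriodic L b') (h : EqOn b b' (cylinderCell L : Set ℝ³)) :
    EqOn (qGrad hL hb) (qGrad hL hb') 𝕂 := by
  have hq := isSmoothPeriodic_qGrad hL hb
  have hq' := isSmoothPeriodic_qGrad hL hb'
  refine eqOn_closure_of_eqOn_cell hL hq.continuousOn hq'.continuousOn hq.periodic hq'.periodic ?_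
  refine eqOn_cylinderCell_of_toCell_eq hq.continuousOn hq'.continuousOn ?_
  rw [toCell_qGrad, toCell_qGrad, toCell_congr fun x hx => h hx]

/-- `Q (b + b') = Q b + Q b'` on the closed cylinder. [folklore] -/
theorem qGrad_add_eqOn {b b' : ℝ³ → ℝ³} (hb : IsSmoothPeriodic L b) (hb' : IsSmoothPeriodic L b') (hs : IsSmoothPeriodic L fun x => b x + b' x) :
    EqOn (qGrad hL hs) (fun x => qGrad hL hb x + qGrad hL hb' x) 𝕂 := by
  have hq := isSmoothPeriodic_qGrad hL hb
  have hq' := isSmoothPeriodic_qGrad hL hb'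
  have hqs := isSmoothPeriodic_qGrad hL hs
  refine eqOn_closure_of_eqOn_cell hL hqs.continuousOn (hq.add hq').continuousOn hqs.periodic (hq.add hq').periodic ?_
  refine eqOn_cylinderCell_of_toCell_eq hqs.continuousOn (hq.add hq').continuousOn ?_
  rw [toCell_qGrad, toCell_add hb.memLp hb'.memLp, map_add, ← toCell_qGrad hL hb, ← toCell_qGrad hL hb', ← toCell_add hq.memLp hq'.memLp]

/-- `Q (c b) = c Q b` on the closed cylinder. [folklore] -/
theorem qGrad_smul_eqOn (c : ℝ) {b : ℝ³ → ℝ³} (hb : IsSmoothPeriodic L b) (hs : IsSmoothPeriodic L fun x => c • b x) :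
    EqOn (qGrad hL hs) (fun x => c • qGrad hL hb x) 𝕂 := by
  have hq := isSmoothPeriodic_qGrad hL hb
  have hqs := isSmoothPeriodic_qGrad hL hs
  refine eqOn_closure_of_eqOn_cell hL hqs.continuousOn (hq.const_smul c).continuousOn hqs.periodic (hq.const_smul c).periodic ?_
  refine eqOn_cylinderCell_of_toCell_eq hqs.continuousOn (hq.const_smul c).continuousOn ?_
  rw [toCell_qGrad, toCell_const_smul c hb.memLp, map_smul, ← toCell_qGrad hL hb, ← toCell_const_smul c hq.memLp]

/-! ### Linearity of the transport field -/

section Smooth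

variable {U U' V : UnitAddTorus (Fin 3) → ℝ³} (hU : IsSmooth U) (hU' : IsSmooth U') (hV : IsSmooth V)
  {c : ℝ} (hs : IsSmooth fun ξ => U ξ + U' ξ) (hcU : IsSmooth fun ξ => c • U ξ)

/-- `fromTorus` of a sum. [folklore] -/
theorem fromTorus_add_apply (x : ℝ³) : fromTorus L (fun ξ => U ξ + U' ξ) x = fromTorus L U x + fromTorus L U' x := rfl

/-- **`T (U + U') = T U + T U'`.** [folklore] -/
theorem transportRep_add : transportRep L hL hs = fun ξ => transportRep L hL hU ξ + transportRep L hL hU' ξ := by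
  have hu := isSmoothPeriodic_fromTorus hL.ne' hU
  have hu' := isSmoothPeriodic_fromTorus hL.ne' hU'
  have hus := isSmoothPeriodic_fromTorus hL.ne' hs
  change transportRep L hL hs = transportRep L hL hU + transportRep L hL hU'
  rw [transportRep, transportRep, transportRep, ← torusRep_add]
  refine torusRep_congr L fun x hx => ?_
  have h := lerayPart_add_eqOn hL (isSmoothPeriodic_fromTorus hL.ne' hU) (isSmoothPeriodic_fromTorus hL.ne' hU')
    (isSmoothPeriodic_fromTorus hL.ne' hs) hx
  show boxInvLin L (lerayPart hL (isSmoothPeriodic_fromTorus hL.ne' hs) x) =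
    boxInvLin L (lerayPart hL (isSmoothPeriodic_fromTorus hL.ne' hU) x) + boxInvLin L (lerayPart hL (isSmoothPeriodic_fromTorus hL.ne' hU') x)
  rw [← map_add]
  exact congrArg (boxInvLin L) h

/-- **`T (c U) = c T U`.** [folklore] -/
theorem transportRep_smul : transportRep L hL hcU = fun ξ => c • transportRep L hL hU ξ := by
  have hu := isSmoothPeriodic_fromTorus hL.ne' hU
  have hs := isSmoothPeriodic_fromTorus hL.ne' hcU
  rw [transportRep, transportRep]
  rw [show (fun ξ => c • torusRep L (fun x => boxInvLin L (lerayPart hL hu x)) ξ) = torusRep L (c • fun x => boxInvLin L (lerayPart hL hu x)) by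
    rw [torusRep_smul]; rfl]
  refine torusRep_congr L fun x hx => ?_
  have h := lerayPart_smul_eqOn hL c (isSmoothPeriodic_fromTorus hL.ne' hU) (isSmoothPeriodic_fromTorus hL.ne' hcU) hx
  show boxInvLin L (lerayPart hL (isSmoothPeriodic_fromTorus hL.ne' hcU) x) = c • boxInvLin L (lerayPart hL (isSmoothPeriodic_fromTorus hL.ne' hU) x)
  rw [← map_smul]
  exact congrArg (boxInvLin L) h

/-! ### The pressure form -/

/-- **The pressure form** `presBil U V = torusRep (Q ((PU·∇_K)(PV)))`. [cite: KatoLai1984, §5 (5.6)] -/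
def presBil (hU : IsSmooth U) (hV : IsSmooth V) : UnitAddTorus (Fin 3) → ℝ³ :=
  torusRep L (qGrad hL (isSmoothPeriodic_cylDeriv (isSmoothPeriodic_lerayPart hL (isSmoothPeriodic_fromTorus hL.ne' hU))
    (isSmoothPeriodic_lerayPart hL (isSmoothPeriodic_fromTorus hL.ne' hV))))

/-- On the diagonal the pressure form is the pressure field of `KatoLaiTorusOperator`. [folklore] -/
theorem presBil_self : presBil hL hU hU = pressureRep L hL hU := rfl

/-- The pressure form is smooth. [folklore] -/
theorem isSmooth_presBil : IsSmooth (presBil hL hU hV) := isSmooth_torusRep (isSmoothPeriodic_qGrad hL _)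

/-- Additivity in the first argument. [folklore] -/
theorem presBil_add_left : presBil hL hs hV = fun ξ => presBil hL hU hV ξ + presBil hL hU' hV ξ := by
  have hu := isSmoothPeriodic_fromTorus hL.ne' hU
  have hu' := isSmoothPeriodic_fromTorus hL.ne' hU'
  have hs := isSmoothPeriodic_fromTorus hL.ne' hs
  have hv := isSmoothPeriodic_fromTorus hL.ne' hV
  have hw := isSmoothPeriodic_lerayPart hL hu
  have hw' := isSmoothPeriodic_lerayPart hL hu'
  have hws := isSmoothPeriodic_lerayPart hL hs
  have hwv := isSmoothPeriodic_lerayPart hL hv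
  have hb := isSmoothPeriodic_cylDeriv hw hwv
  have hb' := isSmoothPeriodic_cylDeriv hw' hwv
  have hbs := isSmoothPeriodic_cylDeriv hws hwv
  have hbb : IsSmoothPeriodic L fun x => cylDeriv (lerayPart hL hu) (lerayPart hL hv) x + cylDeriv (lerayPart hL hu') (lerayPart hL hv) x := hb.add hb'
  change _ = presBil hL hU hV + presBil hL hU' hV
  rw [presBil, presBil, presBil, ← torusRep_add]
  refine torusRep_congr L fun x hx => ?_
  -- `Q b_s = Q (b + b') = Q b + Q b'` on `𝕂`
  have h1 : EqOn (qGrad hL hbs) (qGrad hL hbb) 𝕂 := qGrad_congr hL hbs hbb fun y hy => by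
    have hyK : y ∈ 𝕂 := subset_closure (cylinderCell_le_unitCylinder L hy)
    show cylDeriv (lerayPart hL hs) (lerayPart hL hv) y = cylDeriv (lerayPart hL hu) (lerayPart hL hv) y + cylDeriv (lerayPart hL hu') (lerayPart hL hv) y
    rw [← cylDeriv_field_add]
    exact cylDeriv_congr_field _ (lerayPart_add_eqOn hL hu hu' hs hyK)
  rw [h1 hx, qGrad_add_eqOn hL hb hb' hbb hx]
  rfl

/-- Additivity in the second argument. [folklore] -/
theorem presBil_add_right : presBil hL hV hs = fun ξ => presBil hL hV hU ξ + presBil hL hV hU' ξ := by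
  have hu := isSmoothPeriodic_fromTorus hL.ne' hU
  have hu' := isSmoothPeriodic_fromTorus hL.ne' hU'
  have hs := isSmoothPeriodic_fromTorus hL.ne' hs
  have hv := isSmoothPeriodic_fromTorus hL.ne' hV
  have hw := isSmoothPeriodic_lerayPart hL hu
  have hw' := isSmoothPeriodic_lerayPart hL hu'
  have hws := isSmoothPeriodic_lerayPart hL hs
  have hwv := isSmoothPeriodic_lerayPart hL hv
  have hb := isSmoothPeriodic_cylDeriv hwv hw
  have hb' := isSmoothPeriodic_cylDeriv hwv hw'
  have hbs := isSmoothPeriodic_cylDeriv hwv hws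
  have hbb : IsSmoothPeriodic L fun x => cylDeriv (lerayPart hL hv) (lerayPart hL hu) x + cylDeriv (lerayPart hL hv) (lerayPart hL hu') x := hb.add hb'
  change _ = presBil hL hV hU + presBil hL hV hU'
  rw [presBil, presBil, presBil, ← torusRep_add]
  refine torusRep_congr L fun x hx => ?_
  have h1 : EqOn (qGrad hL hbs) (qGrad hL hbb) 𝕂 := qGrad_congr hL hbs hbb fun y hy => by
    have hyK : y ∈ 𝕂 := subset_closure (cylinderCell_le_unitCylinder L hy)
    show cylDeriv (lerayPart hL hv) (lerayPart hL hs) y = cylDeriv (lerayPart hL hv) (lerayPart hL hu) y + cylDeriv (lerayPart hL hv) (lerayPart hL hu') y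
    rw [← cylDeriv_add hw.smooth hw'.smooth hyK]
    exact congrArg (fun φ : ℝ³ →L[ℝ] ℝ³ => φ (lerayPart hL hv y)) (fderivWithin_congr (lerayPart_add_eqOn hL hu hu' hs) (lerayPart_add_eqOn hL hu hu' hs hyK))
  rw [h1 hx, qGrad_add_eqOn hL hb hb' hbb hx]
  rfl

/-- Homogeneity in the first argument. [folklore] -/
theorem presBil_smul_left : presBil hL hcU hV = fun ξ => c • presBil hL hU hV ξ := by
  have hu := isSmoothPeriodic_fromTorus hL.ne' hU
  have hs := isSmoothPeriodic_fromTorus hL.ne' hcU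
  have hv := isSmoothPeriodic_fromTorus hL.ne' hV
  have hw := isSmoothPeriodic_lerayPart hL hu
  have hws := isSmoothPeriodic_lerayPart hL hs
  have hwv := isSmoothPeriodic_lerayPart hL hv
  have hb := isSmoothPeriodic_cylDeriv hw hwv
  have hbs := isSmoothPeriodic_cylDeriv hws hwv
  have hbb : IsSmoothPeriodic L fun x => c • cylDeriv (lerayPart hL hu) (lerayPart hL hv) x := hb.const_smul c
  rw [presBil, presBil]
  rw [show (fun ξ => c • torusRep L (qGrad hL hb) ξ) = torusRep L (c • qGrad hL hb) by rw [torusRep_smul]; rfl]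
  refine torusRep_congr L fun x hx => ?_
  have h1 : EqOn (qGrad hL hbs) (qGrad hL hbb) 𝕂 := qGrad_congr hL hbs hbb fun y hy => by
    have hyK : y ∈ 𝕂 := subset_closure (cylinderCell_le_unitCylinder L hy)
    show cylDeriv (lerayPart hL hs) (lerayPart hL hv) y = c • cylDeriv (lerayPart hL hu) (lerayPart hL hv) y
    rw [← cylDeriv_field_smul (fun _ => c)]
    exact cylDeriv_congr_field _ (lerayPart_smul_eqOn hL c hu hs hyK)
  rw [h1 hx, qGrad_smul_eqOn hL c hb hbb hx]
  rfl

/-- Homogeneity in the second argument. [folklore] -/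
theorem presBil_smul_right : presBil hL hV hcU = fun ξ => c • presBil hL hV hU ξ := by
  have hu := isSmoothPeriodic_fromTorus hL.ne' hU
  have hs := isSmoothPeriodic_fromTorus hL.ne' hcU
  have hv := isSmoothPeriodic_fromTorus hL.ne' hV
  have hw := isSmoothPeriodic_lerayPart hL hu
  have hws := isSmoothPeriodic_lerayPart hL hs
  have hwv := isSmoothPeriodic_lerayPart hL hv
  have hb := isSmoothPeriodic_cylDeriv hwv hw
  have hbs := isSmoothPeriodic_cylDeriv hwv hws
  have hbb : IsSmoothPeriodic L fun x => c • cylDeriv (lerayPart hL hv) (lerayPart hL hu) x := hb.const_smul c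
  rw [presBil, presBil]
  rw [show (fun ξ => c • torusRep L (qGrad hL hb) ξ) = torusRep L (c • qGrad hL hb) by rw [torusRep_smul]; rfl]
  refine torusRep_congr L fun x hx => ?_
  have h1 : EqOn (qGrad hL hbs) (qGrad hL hbb) 𝕂 := qGrad_congr hL hbs hbb fun y hy => by
    have hyK : y ∈ 𝕂 := subset_closure (cylinderCell_le_unitCylinder L hy)
    show cylDeriv (lerayPart hL hv) (lerayPart hL hs) y = c • cylDeriv (lerayPart hL hv) (lerayPart hL hu) y
    rw [← cylDeriv_const_smul c hw.smooth hyK]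
    exact congrArg (fun φ : ℝ³ →L[ℝ] ℝ³ => φ (lerayPart hL hv y)) (fderivWithin_congr (lerayPart_smul_eqOn hL c hu hs) (lerayPart_smul_eqOn hL c hu hs hyK))
  rw [h1 hx, qGrad_smul_eqOn hL c hb hbb hx]
  rfl

/-! ### The bilinear operator -/

/-- **Kato–Lai's operator as a bilinear form**: `klBil U V = ((T U)·∇)V − ½ (presBil U V + presBil V U)`.
[cite: KatoLai1984, §4, §5 (5.6)] -/
def klBil (hU : IsSmooth U) (hV : IsSmooth V) : UnitAddTorus (Fin 3) → ℝ³ := fun ξ =>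
  Torus.convect (transportRep L hL hU) V ξ - (2 : ℝ)⁻¹ • (presBil hL hU hV ξ + presBil hL hV hU ξ)

/-- **On the diagonal the bilinear form is Kato–Lai's operator.** [folklore] -/
theorem klBil_self : klBil hL hU hU = klOp L hL hU := by
  funext ξ
  rw [klBil, klOp, presBil_self]
  module

/-- The bilinear form is smooth. [folklore] -/
theorem isSmooth_klBil : IsSmooth (klBil hL hU hV) :=
  ((isSmooth_transportRep hL hU).convect hV).sub (((isSmooth_presBil hL hU hV).add (isSmooth_presBil hL hV hU)).const_smul _)

/-- The convective derivative on the torus is additive in the transporting field. [folklore] -/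
theorem convect_add_left (W W' Z : UnitAddTorus (Fin 3) → ℝ³) (ξ : UnitAddTorus (Fin 3)) :
    Torus.convect (fun η => W η + W' η) Z ξ = Torus.convect W Z ξ + Torus.convect W' Z ξ := by
  simp only [Torus.convect, map_add]

/-- The convective derivative on the torus is homogeneous in the transporting field. [folklore] -/
theorem convect_smul_left (c : ℝ) (W Z : UnitAddTorus (Fin 3) → ℝ³) (ξ : UnitAddTorus (Fin 3)) :
    Torus.convect (fun η => c • W η) Z ξ = c • Torus.convect W Z ξ := by
  simp only [Torus.convect, map_smul]

/-- The convective derivative on the torus is additive in the transported field. [folklore] -/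
theorem convect_add_right {W Z Z' : UnitAddTorus (Fin 3) → ℝ³} (hZ : IsSmooth Z) (hZ' : IsSmooth Z') (ξ : UnitAddTorus (Fin 3)) :
    Torus.convect W (fun η => Z η + Z' η) ξ = Torus.convect W Z ξ + Torus.convect W Z' ξ := by
  simp only [Torus.convect, Torus.fderiv]
  have hd : liftAt (fun η => Z η + Z' η) ξ = fun v => liftAt Z ξ v + liftAt Z' ξ v := rfl
  have h1 : DifferentiableAt ℝ (liftAt Z ξ) 0 := (((hZ.isContDiff (n := 1) (by simp)).liftAt ξ).differentiable one_ne_zero).differentiableAt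
  have h2 : DifferentiableAt ℝ (liftAt Z' ξ) 0 := (((hZ'.isContDiff (n := 1) (by simp)).liftAt ξ).differentiable one_ne_zero).differentiableAt
  rw [hd, fderiv_fun_add h1 h2]
  rfl

/-- The convective derivative on the torus is homogeneous in the transported field. [folklore] -/
theorem convect_smul_right (c : ℝ) {W Z : UnitAddTorus (Fin 3) → ℝ³} (hZ : IsSmooth Z) (ξ : UnitAddTorus (Fin 3)) :
    Torus.convect W (fun η => c • Z η) ξ = c • Torus.convect W Z ξ := by
  simp only [Torus.convect, Torus.fderiv]
  have hd : liftAt (fun η => c • Z η) ξ = fun v => c • liftAt Z ξ v := rfl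
  have h1 : DifferentiableAt ℝ (liftAt Z ξ) 0 := (((hZ.isContDiff (n := 1) (by simp)).liftAt ξ).differentiable one_ne_zero).differentiableAt
  rw [hd, fderiv_fun_const_smul h1]
  rfl

/-- **Additivity of `klBil` in the first argument.** [folklore] -/
theorem klBil_add_left : klBil hL hs hV = fun ξ => klBil hL hU hV ξ + klBil hL hU' hV ξ := by
  funext ξ
  simp only [klBil]
  rw [transportRep_add hL hU hU' hs, convect_add_left, presBil_add_left hL hU hU' hV hs, presBil_add_right hL hU hU' hV hs]
  module

/-- **Additivity of `klBil` in the second argument.** [folklore] -/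
theorem klBil_add_right : klBil hL hV hs = fun ξ => klBil hL hV hU ξ + klBil hL hV hU' ξ := by
  funext ξ
  simp only [klBil]
  rw [convect_add_right hU hU', presBil_add_right hL hU hU' hV hs, presBil_add_left hL hU hU' hV hs]
  module

/-- **Homogeneity of `klBil` in the first argument.** [folklore] -/
theorem klBil_smul_left : klBil hL hcU hV = fun ξ => c • klBil hL hU hV ξ := by
  funext ξ
  simp only [klBil]
  rw [transportRep_smul hL hU hcU, convect_smul_left, presBil_smul_left hL hU hV hcU, presBil_smul_right hL hU hV hcU]
  module

/-- **Homogeneity of `klBil` in the second argument.** [folklore] -/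
theorem klBil_smul_right : klBil hL hV hcU = fun ξ => c • klBil hL hV hU ξ := by
  funext ξ
  simp only [klBil]
  rw [convect_smul_right c hU, presBil_smul_right hL hU hV hcU, presBil_smul_left hL hU hV hcU]
  module

end Smooth

end PeriodicCylinder

end Literature.Analysis.FluidPDE
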